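/-
Copyright (c) 2026 the pub-hodgecm-mathlib formalisation cell (harness21).  Prover seat hodgecm-mathlib-K2Liu-p27 (g2), Track B «K2-LIT»,
#184♮ = hLiu418 = `stmt-HodgeConjecture-24832`; RULINGS M-158r∕M-158u (LEAD F0P6-plan (g14)): F4 (G-gen) road (E) «compact see-saw + FFT + PBW +
`K_H`-averaging» (K2E5-r02 (g6) 22:54:25Z), brick (E-c) = STEP 2 «`U(𝔤)·φ° = L⁺ ⊗ L⁻`» at operator level (F4 lead K2Liu-p27; interface 23:05:11Z).
THEOREMS ONLY (no `def`, no `instance`, no notation, no named-fact hypothesis, no `sorry`); lane `--supports stmt-HodgeConjecture-24832 --as helper`.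
-/
import Mathlib.LinearAlgebra.Span.Basic
import Mathlib.Algebra.Algebra.Basic
import Mathlib.Data.Complex.Basic
import HarnessLib

/-!
# Crux `HLiu418`, organ F4 (G-gen), brick (E-c): THE PBW INDUCTION — every balanced product of contractions `(∏ C^R)(∏ C^S)` lies in any subspace
# containing `1` and stable under the `𝔭^±` operators (road (E), STEP 2, operator level, GENERIC)

Cell `hodgecm-mathlib`, crux item hLiu418 = `stmt-HodgeConjecture-24832` (helper lane `--supports`, count-neutral; closes no socket).

ROAD (E) (K2E5-r02 (g6); RULING M-158u): at a real place `σ` of signature `(p,q)`, in the Fock model of the junction Weil datum `U(2,2) × U(p,q)` the `𝔭⁺`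
generators act by `A⁺_{pq₀} = c₁·(C^R_{pq₀} ·) + c₂·Σ_s ∂_{(p,s)}∂′_{(q₀,s)}` (CREATION by the `R`-contraction `C^R_{pq₀} = Σ_r X_{(p,r)} X′_{(q₀,r)}`, annihilation on
the `S`-planes) and the `𝔭⁻` generators by `A⁻_{pq₀} = c₃·(C^S_{pq₀} ·) + c₄·Σ_r ∂∂′` (★ Konno–Konno `JunctionPMinusFockSymbol.hypOpGen_sub∕add_I_smul_rotBoostGen_binvPi`;
brick (E-b) `K2LiuFockPActionLetters`, LH7-p07 (g2), re-exports them with the two Leibniz letters below).  STEP 1 (FFT, (E-a)) says the `K_H`-invariant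
`K̃`-finite vectors are `(∏ C^R)(∏ C^S) · φ°`; STEP 2 — THIS FILE — says every such product is reached from `1` (`= B φ°`) by the operators `A^±`:
«`L⁺ ⊗ L⁻ ⊆ U(𝔭⁺ ⊕ 𝔭⁻)·1`».  The argument is r02's 8-line induction, typed ONCE, GENERICALLY: a commutative `ℂ`-algebra `A`, an index type `ι` (`= Fin 2 × Fin 2`),
elements `CR CS : ι → A`, linear operators `Ap Am : ι → A →ₗ[ℂ] A`, scalars `c₁ c₃ ≠ 0`, and TWO BY-VALUE LETTERS ((E-b) discharges them at the Fock instance):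
* (hAm) `Am i (∏_τ CS) = c₃ • (CS i * ∏_τ CS)` — on pure `S`-products the annihilation half of `𝔭⁻` dies (no `R`-variables);
* (hAp) `Ap i (∏_ρ CR * ∏_τ CS) − c₁ • (CR i * ∏_ρ CR * ∏_τ CS) ∈ span {∏_ρ CR * ∏_{τ′} CS : |τ′| < |τ|}` — the annihilation half of `𝔭⁺` hits only the `S`-product
  and SHORTENS it (Leibniz twice: `Σ_s ∂_{(p,s)}∂′_{(q,s)}` of a product of `S`-contractions is a combination of products with one factor fewer — the `𝔨`-commutator).
* §1 **`prod_CS_mem`** (pure `S`-products, induction on `τ`) and **`prod_CR_mul_prod_CS_mem`** — THE HEAD: `∀ M, 1 ∈ M → Ap-stable → Am-stable →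
  ∀ ρ τ, ∏_ρ CR * ∏_τ CS ∈ M` (strong induction on `|τ|`, inner induction on `ρ`; `c₁ ≠ 0` divides out).
* §2 TRANSPORT through a linear map `B : A →ₗ[ℂ] V` intertwining `Ap i ∕ Am i` with operators `ωp i ∕ ωm i` on `V` (`B` = the inverse Bargmann map `binvPi`,
  `ω` = the infinitesimal Weil representation, ★ symbols): **`map_prod_mem_of_stable`** — `B(∏_ρ CR * ∏_τ CS)` lies in every `ω^±`-stable subspace of `V` containing
  `B 1 = φ°`; and the predicate form **`induction_on_balanced_products`** (a property of vectors closed under `0, +, •` and the `ω^±` holding at `φ°` holds at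
  every `B(∏ CR ∏ CS)`) — the shape (E-f) `K2LiuLocalThetaCyclicUniform` and p10's L3 consume.
* §3 (ED. 2) the same two with UNBUNDLED vector operators `ωp ωm : ι → V → V` (the ★ Schwartz-side symbols are only `ℝ`-linearly bundled).
No freeness∕irreducibility of `L^±`, no `I(½,χ)` structure, no K-type table.  References: [Howe1989, §3 (see-saw, oscillator PBW)]; [KashiwaraVergne1978, §II.5];
[KudlaRallis1994, §3 (citation only)] — the file itself is elementary linear algebra.
HONEST LABEL: HC_CM is proved only modulo the 7 printed citations (2 remaining named inputs: hLiu418 = stmt-HodgeConjecture-24832,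
h413 = stmt-HodgeConjecture-24833) until rung 0 closes; count-neutral helper, closes no socket.
-/

set_option autoImplicit false
set_option linter.dupNamespace false -- the mandated namespace repeats `HodgeConjecture.HodgeConjecture`

namespace Summit.HodgeConjecture.HodgeConjecture.Cruxes.HLiu418.K2LiuFockPBWInduction

/-! ## §1 The induction -/

section Induction

variable {A : Type*} [CommRing A] [Algebra ℂ A] {ι : Type*}
  (CR CS : ι → A) (Ap Am : ι → A →ₗ[ℂ] A) {c₁ c₃ : ℂ}

/-- **PURE `S`-PRODUCTS**: if `Am i` acts on every pure `S`-product as multiplication by `c₃ • CS i` (`c₃ ≠ 0`), then every subspace `M ∋ 1` stable under the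
`Am i` contains every `∏_τ CS` («`U(𝔭⁻)·φ°₋ = L⁻`», induction on the word `τ`). [cite: Howe1989, §3] -/
theorem prod_CS_mem (hc₃ : c₃ ≠ 0)
    (hAm : ∀ (τ : List ι) (i : ι), Am i (τ.map CS).prod = c₃ • (CS i * (τ.map CS).prod))
    (M : Submodule ℂ A) (h1 : (1 : A) ∈ M) (hM : ∀ i, ∀ F ∈ M, Am i F ∈ M) (τ : List ι) : (τ.map CS).prod ∈ M := by
  induction τ with
  | nil => simpa using h1
  | cons i τ ih =>
    rw [List.map_cons, List.prod_cons]
    have h := hM i _ ih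
    rw [hAm τ i] at h
    exact (Submodule.smul_mem_iff M hc₃).1 h

/-- **THE PBW INDUCTION (road (E) STEP 2)**: with (hAm) as above and (hAp) «`Ap i (∏_ρ CR * ∏_τ CS) − c₁ • (CR i * ∏_ρ CR * ∏_τ CS)` lies in the span of the
products `∏_ρ CR * ∏_{τ′} CS` with `|τ′| < |τ|`» (`c₁ ≠ 0`), EVERY balanced product `∏_ρ CR * ∏_τ CS` lies in every subspace `M ∋ 1` stable under all `Ap i`,
`Am i` — strong induction on `|τ|`, inner induction on `ρ`. («`L⁺ ⊗ L⁻ ⊆ U(𝔭⁺ ⊕ 𝔭⁻)·1`»; no freeness, no irreducibility.) [cite: Howe1989, §3] [cite: KashiwaraVergne1978, §II.5] -/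
theorem prod_CR_mul_prod_CS_mem (hc₁ : c₁ ≠ 0) (hc₃ : c₃ ≠ 0)
    (hAm : ∀ (τ : List ι) (i : ι), Am i (τ.map CS).prod = c₃ • (CS i * (τ.map CS).prod))
    (hAp : ∀ (ρ τ : List ι) (i : ι),
      Ap i ((ρ.map CR).prod * (τ.map CS).prod) - c₁ • (CR i * (ρ.map CR).prod * (τ.map CS).prod) ∈
        Submodule.span ℂ {x : A | ∃ τ' : List ι, τ'.length < τ.length ∧ x = (ρ.map CR).prod * (τ'.map CS).prod})
    (M : Submodule ℂ A) (h1 : (1 : A) ∈ M) (hP : ∀ i, ∀ F ∈ M, Ap i F ∈ M) (hM : ∀ i, ∀ F ∈ M, Am i F ∈ M)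
    (ρ τ : List ι) : (ρ.map CR).prod * (τ.map CS).prod ∈ M := by
  -- strong induction on the length of the `S`-word
  suffices h : ∀ (n : ℕ) (τ : List ι), τ.length = n → ∀ ρ : List ι, (ρ.map CR).prod * (τ.map CS).prod ∈ M from h _ τ rfl ρ
  intro n
  induction n using Nat.strong_induction_on with
  | _ n ihn =>
    intro τ hτ ρ
    induction ρ with
    | nil =>
      rw [List.map_nil, List.prod_nil, one_mul]
      exact prod_CS_mem CS Am hc₃ hAm M h1 hM τ
    | cons i ρ ihρ =>
      rw [List.map_cons, List.prod_cons]
      -- the shorter products (same `ρ`) are in `M` by the outer hypothesis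
      have hle : Submodule.span ℂ {x : A | ∃ τ' : List ι, τ'.length < τ.length ∧ x = (ρ.map CR).prod * (τ'.map CS).prod} ≤ M := by
        refine Submodule.span_le.2 ?_
        rintro x ⟨τ', hτ', rfl⟩
        exact ihn τ'.length (by omega) τ' rfl ρ
      have hG : (ρ.map CR).prod * (τ.map CS).prod ∈ M := ihρ
      have hA : Ap i ((ρ.map CR).prod * (τ.map CS).prod) ∈ M := hP i _ hG
      have hdiff := hle (hAp ρ τ i)
      have hc : c₁ • (CR i * (ρ.map CR).prod * (τ.map CS).prod) ∈ M := by
        have := M.sub_mem hA hdiff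
        rwa [sub_sub_cancel] at this
      exact (Submodule.smul_mem_iff M hc₁).1 hc

end Induction

/-! ## §2 Transport through the (inverse Bargmann) map and the predicate form -/

section Transport

variable {A : Type*} [CommRing A] [Algebra ℂ A] {ι : Type*} {V : Type*} [AddCommGroup V] [Module ℂ V]
  (CR CS : ι → A) (Ap Am : ι → A →ₗ[ℂ] A) {c₁ c₃ : ℂ}
  (B : A →ₗ[ℂ] V) (ωp ωm : ι → V →ₗ[ℂ] V)

/-- **TRANSPORT**: if `B : A →ₗ V` intertwines `Ap i ∕ Am i` with `ωp i ∕ ωm i` (`B` = `binvPi`, `ω` = the infinitesimal Weil representation — the ★ Konno–Konno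
symbols read `ω(X^±) (B F) = B (A^± F)`), then `B (∏_ρ CR * ∏_τ CS)` lies in EVERY subspace `N` of `V` containing `B 1` (`= φ°`) and stable under all `ωp i`,
`ωm i` — «the `K_H`-invariant `K̃`-finite vectors lie in `U(𝔭⁺ ⊕ 𝔭⁻)·φ°`» once (E-a)∕(E-e) identify them with the `B(∏ CR ∏ CS)`. [cite: Howe1989, §3] -/
theorem map_prod_mem_of_stable (hc₁ : c₁ ≠ 0) (hc₃ : c₃ ≠ 0)
    (hAm : ∀ (τ : List ι) (i : ι), Am i (τ.map CS).prod = c₃ • (CS i * (τ.map CS).prod))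
    (hAp : ∀ (ρ τ : List ι) (i : ι),
      Ap i ((ρ.map CR).prod * (τ.map CS).prod) - c₁ • (CR i * (ρ.map CR).prod * (τ.map CS).prod) ∈
        Submodule.span ℂ {x : A | ∃ τ' : List ι, τ'.length < τ.length ∧ x = (ρ.map CR).prod * (τ'.map CS).prod})
    (hBp : ∀ i F, B (Ap i F) = ωp i (B F)) (hBm : ∀ i F, B (Am i F) = ωm i (B F))
    (N : Submodule ℂ V) (h1 : B 1 ∈ N) (hNp : ∀ i, ∀ v ∈ N, ωp i v ∈ N) (hNm : ∀ i, ∀ v ∈ N, ωm i v ∈ N)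
    (ρ τ : List ι) : B ((ρ.map CR).prod * (τ.map CS).prod) ∈ N := by
  have h := prod_CR_mul_prod_CS_mem CR CS Ap Am hc₁ hc₃ hAm hAp (N.comap B) h1
    (fun i F hF => by
      show B (Ap i F) ∈ N
      rw [hBp]
      exact hNp i _ hF)
    (fun i F hF => by
      show B (Am i F) ∈ N
      rw [hBm]
      exact hNm i _ hF)
    ρ τ
  exact h

/-- **PREDICATE FORM (the shape (E-f) and p10's L3 consume)**: a property `Good` of vectors closed under `0`, `+`, scalars and the operators `ωp i`, `ωm i`,
which holds at `φ° = B 1`, holds at every `B (∏_ρ CR * ∏_τ CS)`. [cite: Howe1989, §3] -/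
theorem induction_on_balanced_products (hc₁ : c₁ ≠ 0) (hc₃ : c₃ ≠ 0)
    (hAm : ∀ (τ : List ι) (i : ι), Am i (τ.map CS).prod = c₃ • (CS i * (τ.map CS).prod))
    (hAp : ∀ (ρ τ : List ι) (i : ι),
      Ap i ((ρ.map CR).prod * (τ.map CS).prod) - c₁ • (CR i * (ρ.map CR).prod * (τ.map CS).prod) ∈
        Submodule.span ℂ {x : A | ∃ τ' : List ι, τ'.length < τ.length ∧ x = (ρ.map CR).prod * (τ'.map CS).prod})
    (hBp : ∀ i F, B (Ap i F) = ωp i (B F)) (hBm : ∀ i F, B (Am i F) = ωm i (B F))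
    {Good : V → Prop} (h0 : Good 0) (hadd : ∀ v w, Good v → Good w → Good (v + w)) (hsmul : ∀ (c : ℂ) v, Good v → Good (c • v))
    (hbase : Good (B 1)) (hωp : ∀ i v, Good v → Good (ωp i v)) (hωm : ∀ i v, Good v → Good (ωm i v))
    (ρ τ : List ι) : Good (B ((ρ.map CR).prod * (τ.map CS).prod)) := by
  let N : Submodule ℂ V :=
    { carrier := {v | Good v}
      add_mem' := fun {v w} hv hw => hadd v w hv hw
      zero_mem' := h0
      smul_mem' := fun c {v} hv => hsmul c v hv }
  exact map_prod_mem_of_stable CR CS Ap Am B ωp ωm hc₁ hc₃ hAm hAp hBp hBm N hbase (fun i v hv => hωp i v hv) (fun i v hv => hωm i v hv) ρ τ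

/-- **LINEAR-COMBINATION FORM**: the same for every element of the span of the balanced products (the whole of `L⁺ ⊗ L⁻` once (E-a) says the balanced
invariants ARE that span). [cite: Howe1989, §3] -/
theorem map_mem_of_mem_span_balanced (hc₁ : c₁ ≠ 0) (hc₃ : c₃ ≠ 0)
    (hAm : ∀ (τ : List ι) (i : ι), Am i (τ.map CS).prod = c₃ • (CS i * (τ.map CS).prod))
    (hAp : ∀ (ρ τ : List ι) (i : ι),
      Ap i ((ρ.map CR).prod * (τ.map CS).prod) - c₁ • (CR i * (ρ.map CR).prod * (τ.map CS).prod) ∈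
        Submodule.span ℂ {x : A | ∃ τ' : List ι, τ'.length < τ.length ∧ x = (ρ.map CR).prod * (τ'.map CS).prod})
    (hBp : ∀ i F, B (Ap i F) = ωp i (B F)) (hBm : ∀ i F, B (Am i F) = ωm i (B F))
    (N : Submodule ℂ V) (h1 : B 1 ∈ N) (hNp : ∀ i, ∀ v ∈ N, ωp i v ∈ N) (hNm : ∀ i, ∀ v ∈ N, ωm i v ∈ N)
    {F : A} (hF : F ∈ Submodule.span ℂ {x : A | ∃ ρ τ : List ι, x = (ρ.map CR).prod * (τ.map CS).prod}) : B F ∈ N := by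
  have hle : Submodule.span ℂ {x : A | ∃ ρ τ : List ι, x = (ρ.map CR).prod * (τ.map CS).prod} ≤ N.comap B := by
    refine Submodule.span_le.2 ?_
    rintro x ⟨ρ, τ, rfl⟩
    exact map_prod_mem_of_stable CR CS Ap Am B ωp ωm hc₁ hc₃ hAm hAp hBp hBm N h1 hNp hNm ρ τ
  exact hle hF

end Transport

/-! ## §3 (ED. 2) Transport with UNBUNDLED vector operators

The Schwartz-side `𝔭^±` operators of ★ Konno–Konno (`hypOpGen`, `rotBoostGen θ`) are bundled `ℝ`-linear (`→L[ℝ]`), and §2 never uses linearity of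
`ωp i`, `ωm i`; these twins take plain functions `ωp ωm : ι → V → V` so that (E-b)'s intertwining letter instantiates with zero glue. -/

section TransportFun

variable {A : Type*} [CommRing A] [Algebra ℂ A] {ι : Type*} {V : Type*} [AddCommGroup V] [Module ℂ V]
  (CR CS : ι → A) (Ap Am : ι → A →ₗ[ℂ] A) {c₁ c₃ : ℂ}
  (B : A →ₗ[ℂ] V) (ωp ωm : ι → V → V)

/-- **TRANSPORT, UNBUNDLED OPERATORS**: as `map_prod_mem_of_stable` with `ωp ωm : ι → V → V` arbitrary functions. [cite: Howe1989, §3] -/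
theorem map_prod_mem_of_stable_fun (hc₁ : c₁ ≠ 0) (hc₃ : c₃ ≠ 0)
    (hAm : ∀ (τ : List ι) (i : ι), Am i (τ.map CS).prod = c₃ • (CS i * (τ.map CS).prod))
    (hAp : ∀ (ρ τ : List ι) (i : ι),
      Ap i ((ρ.map CR).prod * (τ.map CS).prod) - c₁ • (CR i * (ρ.map CR).prod * (τ.map CS).prod) ∈
        Submodule.span ℂ {x : A | ∃ τ' : List ι, τ'.length < τ.length ∧ x = (ρ.map CR).prod * (τ'.map CS).prod})
    (hBp : ∀ i F, B (Ap i F) = ωp i (B F)) (hBm : ∀ i F, B (Am i F) = ωm i (B F))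
    (N : Submodule ℂ V) (h1 : B 1 ∈ N) (hNp : ∀ i, ∀ v ∈ N, ωp i v ∈ N) (hNm : ∀ i, ∀ v ∈ N, ωm i v ∈ N)
    (ρ τ : List ι) : B ((ρ.map CR).prod * (τ.map CS).prod) ∈ N := by
  have h := prod_CR_mul_prod_CS_mem CR CS Ap Am hc₁ hc₃ hAm hAp (N.comap B) h1
    (fun i F hF => by
      show B (Ap i F) ∈ N
      rw [hBp]
      exact hNp i _ hF)
    (fun i F hF => by
      show B (Am i F) ∈ N
      rw [hBm]
      exact hNm i _ hF)
    ρ τ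
  exact h

/-- **PREDICATE FORM, UNBUNDLED OPERATORS**. [cite: Howe1989, §3] -/
theorem induction_on_balanced_products_fun (hc₁ : c₁ ≠ 0) (hc₃ : c₃ ≠ 0)
    (hAm : ∀ (τ : List ι) (i : ι), Am i (τ.map CS).prod = c₃ • (CS i * (τ.map CS).prod))
    (hAp : ∀ (ρ τ : List ι) (i : ι),
      Ap i ((ρ.map CR).prod * (τ.map CS).prod) - c₁ • (CR i * (ρ.map CR).prod * (τ.map CS).prod) ∈
        Submodule.span ℂ {x : A | ∃ τ' : List ι, τ'.length < τ.length ∧ x = (ρ.map CR).prod * (τ'.map CS).prod})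
    (hBp : ∀ i F, B (Ap i F) = ωp i (B F)) (hBm : ∀ i F, B (Am i F) = ωm i (B F))
    {Good : V → Prop} (h0 : Good 0) (hadd : ∀ v w, Good v → Good w → Good (v + w)) (hsmul : ∀ (c : ℂ) v, Good v → Good (c • v))
    (hbase : Good (B 1)) (hωp : ∀ i v, Good v → Good (ωp i v)) (hωm : ∀ i v, Good v → Good (ωm i v))
    (ρ τ : List ι) : Good (B ((ρ.map CR).prod * (τ.map CS).prod)) := by
  let N : Submodule ℂ V :=
    { carrier := {v | Good v}
      add_mem' := fun {v w} hv hw => hadd v w hv hw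
      zero_mem' := h0
      smul_mem' := fun c {v} hv => hsmul c v hv }
  exact map_prod_mem_of_stable_fun CR CS Ap Am B ωp ωm hc₁ hc₃ hAm hAp hBp hBm N hbase (fun i v hv => hωp i v hv) (fun i v hv => hωm i v hv) ρ τ

/-- **LINEAR-COMBINATION FORM, UNBUNDLED OPERATORS**. [cite: Howe1989, §3] -/
theorem map_mem_of_mem_span_balanced_fun (hc₁ : c₁ ≠ 0) (hc₃ : c₃ ≠ 0)
    (hAm : ∀ (τ : List ι) (i : ι), Am i (τ.map CS).prod = c₃ • (CS i * (τ.map CS).prod))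
    (hAp : ∀ (ρ τ : List ι) (i : ι),
      Ap i ((ρ.map CR).prod * (τ.map CS).prod) - c₁ • (CR i * (ρ.map CR).prod * (τ.map CS).prod) ∈
        Submodule.span ℂ {x : A | ∃ τ' : List ι, τ'.length < τ.length ∧ x = (ρ.map CR).prod * (τ'.map CS).prod})
    (hBp : ∀ i F, B (Ap i F) = ωp i (B F)) (hBm : ∀ i F, B (Am i F) = ωm i (B F))
    (N : Submodule ℂ V) (h1 : B 1 ∈ N) (hNp : ∀ i, ∀ v ∈ N, ωp i v ∈ N) (hNm : ∀ i, ∀ v ∈ N, ωm i v ∈ N)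
    {F : A} (hF : F ∈ Submodule.span ℂ {x : A | ∃ ρ τ : List ι, x = (ρ.map CR).prod * (τ.map CS).prod}) : B F ∈ N := by
  have hle : Submodule.span ℂ {x : A | ∃ ρ τ : List ι, x = (ρ.map CR).prod * (τ.map CS).prod} ≤ N.comap B := by
    refine Submodule.span_le.2 ?_
    rintro x ⟨ρ, τ, rfl⟩
    exact map_prod_mem_of_stable_fun CR CS Ap Am B ωp ωm hc₁ hc₃ hAm hAp hBp hBm N h1 hNp hNm ρ τ
  exact hle hF

end TransportFun

end Summit.HodgeConjecture.HodgeConjecture.Cruxes.HLiu418.K2LiuFockPBWInduction
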